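import Summits.QuantumAdvantage.QuantumAdvantage.Theorems.WalkThreeStepFarReadPair

/-!
# Rung (G♯₂) `ThreeStepFreeRungFive` (item stmt-QuantumAdvantage-23286), architecture (U), the FAR-READ LEMMA 3/6: indicator inputs
# and the residue functions

Cell qa-qnc0, route OddPrimeWalk, support item stmt-QuantumAdvantage-23286; prover qn-prover-3 g17.

§1 INDICATOR INPUTS `indic P` of a finite set `P ⊆ [0, n)` of positions: prefix counts are cardinalities (`wtPrefix_indic`,
`wt_indic`), adding a disjoint block `Ico β (β + j)` raises `N(r)` by `min (β + j) r − β` (`card_lt_union_Ico`), patterns `Ten` are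
membership conditions (`ten_indic`).  §2 the RESIDUE FUNCTIONS: the `π`-difference `δ` of a cut reading `π` is `dfun a b γ r (N π) (N ρ) W`
(`dlt_eq_dfun`), the four-fold difference of a double reader of `{π, h}` is `cfun a b γ r (N π) (N h) W` (`c4_eq_cfun`).  §3 the three
abstract contradictions in this language: the Y-FAMILY lemma (`dfun = cfun` along five consecutive values of `N(π)` is impossible,
`yfam_false`), the T-FAMILY lemma (a constant `d = cfun` along five consecutive values of `N(h)` forces `d = 0`, `tfam_zero`), and the
LINE-WITNESS lemma (`cfun` takes the value `1` somewhere along any arithmetic progression of non-zero step, `exists_cfun_true`).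
WHAT THIS IS NOT: bookkeeping; separation NOT moved.
-/

namespace Summit.QuantumAdvantage.AdviceFreeQNC0.LocalEngine

open Finset Classical

namespace RungU

variable {p n : ℕ}

/-! ### §1 Indicator inputs -/

/-- the input with ones exactly at the positions of `P` (positions `≥ n` are ignored). -/
def indic (P : Finset ℕ) : Fin n → Bool := fun i => decide (i.val ∈ P)

/-- value of an indicator input. -/
theorem indic_apply (P : Finset ℕ) (i : Fin n) : indic P i = decide (i.val ∈ P) := rfl

/-- `indic P i = true ↔ i ∈ P`. -/
theorem indic_eq_true (P : Finset ℕ) (i : Fin n) : indic P i = true ↔ i.val ∈ P := by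
  unfold indic; simp

/-- **prefix counts of an indicator input are cardinalities** (`P ⊆ [0, n)`). -/
theorem wtPrefix_indic (P : Finset ℕ) (hP : ∀ j ∈ P, j < n) (r : ℕ) :
    wtPrefix (indic P : Fin n → Bool) r = (P.filter fun j => j < r).card := by
  unfold wtPrefix
  have himg : ((univ.filter fun i : Fin n => i.val < r ∧ indic P i = true).image Fin.val) = P.filter fun j => j < r := by
    ext j
    simp only [Finset.mem_image, Finset.mem_filter, Finset.mem_univ, true_and, indic_eq_true]
    constructor
    · rintro ⟨i, ⟨h1, h2⟩, rfl⟩; exact ⟨h2, h1⟩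
    · rintro ⟨h1, h2⟩; exact ⟨⟨j, hP j h1⟩, ⟨h2, h1⟩, rfl⟩
  rw [← himg, Finset.card_image_of_injective _ Fin.val_injective]

/-- the weight of an indicator input. -/
theorem wt_indic (P : Finset ℕ) (hP : ∀ j ∈ P, j < n) : wt (indic P : Fin n → Bool) = P.card := by
  rw [Coset21.wt_eq_wtPrefix, wtPrefix_indic P hP n]
  congr 1
  exact Finset.filter_true_of_mem hP

/-- cardinality below `r` of a disjoint union. -/
theorem card_lt_union (A B : Finset ℕ) (h : Disjoint A B) (r : ℕ) :
    ((A ∪ B).filter fun j => j < r).card = (A.filter fun j => j < r).card + (B.filter fun j => j < r).card := by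
  rw [Finset.filter_union, Finset.card_union_of_disjoint (Finset.disjoint_filter_filter h)]

/-- cardinality below `r` of a block `[β, β + j)`: `min (β + j) r − β`. -/
theorem card_lt_Ico (β j r : ℕ) : ((Ico β (β + j)).filter fun i => i < r).card = min (β + j) r - β := by
  rw [Finset.Ico_filter_lt, Nat.card_Ico]

/-- a block entirely below `r` counts fully … -/
theorem card_lt_Ico_of_le (β j r : ℕ) (h : β + j ≤ r) : ((Ico β (β + j)).filter fun i => i < r).card = j := by
  rw [card_lt_Ico, min_eq_left h]; omega

/-- … and a block entirely at or above `r` counts nothing. -/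
theorem card_lt_Ico_of_ge (β j r : ℕ) (h : r ≤ β) : ((Ico β (β + j)).filter fun i => i < r).card = 0 := by
  rw [card_lt_Ico]
  have : min (β + j) r ≤ β := (min_le_right _ _).trans h
  omega

/-- cardinality below `r` of a singleton. -/
theorem card_lt_singleton (a r : ℕ) : (({a} : Finset ℕ).filter fun i => i < r).card = if a < r then 1 else 0 := by
  by_cases h : a < r
  · rw [if_pos h, Finset.filter_singleton, if_pos h, Finset.card_singleton]
  · rw [if_neg h, Finset.filter_singleton, if_neg h, Finset.card_empty]

/-- **adding a disjoint block** raises every prefix count by the part of the block below. -/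
theorem wtPrefix_indic_union_Ico (P : Finset ℕ) (hP : ∀ j ∈ P, j < n) (β j : ℕ) (hβ : β + j ≤ n)
    (hdis : ∀ i ∈ P, ¬ (β ≤ i ∧ i < β + j)) (r : ℕ) :
    wtPrefix (indic (P ∪ Ico β (β + j)) : Fin n → Bool) r = wtPrefix (indic P : Fin n → Bool) r + (min (β + j) r - β) := by
  have hP' : ∀ i ∈ P ∪ Ico β (β + j), i < n := by
    intro i hi
    rw [Finset.mem_union, Finset.mem_Ico] at hi
    rcases hi with hi | hi
    · exact hP i hi
    · omega
  have hd : Disjoint P (Ico β (β + j)) := by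
    rw [Finset.disjoint_left]
    intro i hi hI
    rw [Finset.mem_Ico] at hI
    exact hdis i hi hI
  rw [wtPrefix_indic _ hP' r, wtPrefix_indic _ hP r, card_lt_union P _ hd r, card_lt_Ico]

/-- the weight after adding a disjoint block. -/
theorem wt_indic_union_Ico (P : Finset ℕ) (hP : ∀ j ∈ P, j < n) (β j : ℕ) (hβ : β + j ≤ n)
    (hdis : ∀ i ∈ P, ¬ (β ≤ i ∧ i < β + j)) :
    wt (indic (P ∪ Ico β (β + j)) : Fin n → Bool) = wt (indic P : Fin n → Bool) + j := by
  rw [Coset21.wt_eq_wtPrefix, Coset21.wt_eq_wtPrefix, wtPrefix_indic_union_Ico P hP β j hβ hdis n, min_eq_left hβ]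
  omega

/-- the pattern `10` at `k` for an indicator input: `k − 1 ∈ P`, `k ∉ P`. -/
theorem ten_indic (P : Finset ℕ) {k : ℕ} (hk1 : 1 ≤ k) (hin : k - 1 ∈ P) (hout : k ∉ P) : Ten (indic P : Fin n → Bool) k := by
  intro i
  constructor
  · intro hi
    rw [indic_eq_true]
    have : i.val = k - 1 := by omega
    rw [this]; exact hin
  · intro hi
    unfold indic
    rw [hi]
    simp [hout]

/-- the label of a cut at an indicator input. -/
theorem lab_indic (P : Finset ℕ) (hP : ∀ j ∈ P, j < n) (q : Fin (n + 1)) :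
    lab (indic P : Fin n → Bool) q = ((q.val + (P.filter fun j => j < q.val).card : ℕ) : ZMod 3) := by
  unfold lab
  rw [wtPrefix_indic P hP]

/-! ### §2 The residue functions -/

/-- the `π`-difference of a line indicator: `[a y + b z + γ w = r] + [a (y−1) + b z + γ w = r]`. -/
def dfun (a b γ r y z w : ZMod 5) : Bool :=
  xor (decide (a * y + b * z + γ * w = r)) (decide (a * (y - 1) + b * z + γ * w = r))

/-- the four-fold difference of a line indicator in `(y, t)`. -/
def cfun (a b γ r y t w : ZMod 5) : Bool :=
  xor (xor (decide (a * y + b * t + γ * w = r)) (decide (a * (y - 1) + b * t + γ * w = r)))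
    (xor (decide (a * y + b * (t - 1) + γ * w = r)) (decide (a * (y - 1) + b * (t - 1) + γ * w = r)))

/-- cast of a prefix count lowered by one. -/
theorem cast_pred {m k : ℕ} (h : m + 1 = k) : ((m : ℕ) : ZMod 5) = ((k : ℕ) : ZMod 5) - 1 := by
  rw [← h]; push_cast; ring

/-- the reads of a cut reading `π` effectively are `π` and the other read. -/
theorem read_eq_of_cf (S : ThreeStep p n) (q : Fin (n + 1)) {π : ℕ} (hπ : cf S q π ≠ 0) {r : ℕ} (hr : cf S q r ≠ 0) :
    r = π ∨ r = otherRead S q π := by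
  unfold otherRead
  unfold cf at hr
  by_cases hs : S.s q = r
  · by_cases hs' : S.s q = π
    · left; rw [← hs, hs']
    · right; rw [if_neg hs']; exact hs.symm
  · rw [if_neg hs, zero_add] at hr
    by_cases hm : max (S.s q) (S.t q) = r
    · by_cases hs' : S.s q = π
      · right; rw [if_pos hs']; exact hm.symm
      · -- then π must be the max read, so r = π
        unfold cf at hπ
        rw [if_neg hs', zero_add] at hπ
        by_cases hm' : max (S.s q) (S.t q) = π
        · left; rw [← hm, hm']
        · rw [if_neg hm'] at hπ; exact absurd rfl hπ
    · rw [if_neg hm] at hr; exact absurd rfl hr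

/-- the other read's contribution is unchanged by the transposition at `π` (it is a different position, or has coefficient `0`). -/
theorem otherCoef_mul_cornerFlip (S : ThreeStep 5 n) (q : Fin (n + 1)) (π : ℕ) (x : Fin n → Bool) :
    otherCoef S q π * ((wtPrefix (cornerFlip n π x) (otherRead S q π) : ℕ) : ZMod 5)
      = otherCoef S q π * ((wtPrefix x (otherRead S q π) : ℕ) : ZMod 5) := by
  by_cases h : otherRead S q π = π
  · have : otherCoef S q π = 0 := by unfold otherCoef; rw [if_pos h]
    rw [this, zero_mul, zero_mul]
  · rw [wtPrefix_cornerFlip π x h]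

/-- **`δ = dfun`**: at an input with `10` at `π`, the `π`-difference of a cut reading `π` is `dfun a b γ r (N π) (N ρ) W`. -/
theorem dlt_eq_dfun (S : ThreeStep 5 n) (q : Fin (n + 1)) {π : ℕ} (hπ : cf S q π ≠ 0) (hπ1 : 1 ≤ π) (hπn : π < n)
    {x : Fin n → Bool} (hx : Ten x π) :
    dlt S π x q = dfun (cf S q π) (otherCoef S q π) (S.γ q) (S.r q) ((wtPrefix x π : ℕ) : ZMod 5)
      ((wtPrefix x (otherRead S q π) : ℕ) : ZMod 5) ((wt x : ℕ) : ZMod 5) := by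
  unfold dlt dfun
  rw [y_eq_cf S q π hπ x, y_eq_cf S q π hπ (cornerFlip n π x), otherCoef_mul_cornerFlip, wt_cornerFlip,
    cast_pred (hx.wtPrefix_cornerFlip hπ1 hπn)]

/-- **`c = cfun`**: at an input with `10` at `π` and at `h` (`|π − h| ≥ 2`), the four-fold difference of a cut reading both `π` and
`h` effectively is `cfun a b γ r (N π) (N h) W`. -/
theorem c4_eq_cfun (S : ThreeStep 5 n) (q : Fin (n + 1)) {π h : ℕ} (hπh : π + 2 ≤ h ∨ h + 2 ≤ π) (hπ : cf S q π ≠ 0)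
    (hh : cf S q h ≠ 0) (hπ1 : 1 ≤ π) (hπn : π < n) (hh1 : 1 ≤ h) (hhn : h < n) {x : Fin n → Bool} (hxπ : Ten x π)
    (hxh : Ten x h) :
    c4 S π h x q = cfun (cf S q π) (cf S q h) (S.γ q) (S.r q) ((wtPrefix x π : ℕ) : ZMod 5) ((wtPrefix x h : ℕ) : ZMod 5)
      ((wt x : ℕ) : ZMod 5) := by
  have hne : π ≠ h := by omega
  have hxπ' : Ten (cornerFlip n h x) π := hxπ.cornerFlip_far h hπh
  have c1 : ((wtPrefix (cornerFlip n π x) π : ℕ) : ZMod 5) = ((wtPrefix x π : ℕ) : ZMod 5) - 1 :=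
    cast_pred (hxπ.wtPrefix_cornerFlip hπ1 hπn)
  have c2 : wtPrefix (cornerFlip n π x) h = wtPrefix x h := wtPrefix_cornerFlip π x (Ne.symm hne)
  have c3 : wtPrefix (cornerFlip n h x) π = wtPrefix x π := wtPrefix_cornerFlip h x hne
  have c4' : ((wtPrefix (cornerFlip n h x) h : ℕ) : ZMod 5) = ((wtPrefix x h : ℕ) : ZMod 5) - 1 :=
    cast_pred (hxh.wtPrefix_cornerFlip hh1 hhn)
  have c5 : ((wtPrefix (cornerFlip n π (cornerFlip n h x)) π : ℕ) : ZMod 5) = ((wtPrefix x π : ℕ) : ZMod 5) - 1 := by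
    rw [cast_pred (hxπ'.wtPrefix_cornerFlip hπ1 hπn), c3]
  have c6 : ((wtPrefix (cornerFlip n π (cornerFlip n h x)) h : ℕ) : ZMod 5) = ((wtPrefix x h : ℕ) : ZMod 5) - 1 := by
    rw [wtPrefix_cornerFlip π _ (Ne.symm hne), c4']
  unfold c4 dlt cfun
  rw [y_eq_cf_pair S q hne hπ hh, y_eq_cf_pair S q hne hπ hh, y_eq_cf_pair S q hne hπ hh, y_eq_cf_pair S q hne hπ hh]
  simp only [wt_cornerFlip, c1, c2, c3, c4', c5, c6]

/-! ### §3 The three abstract contradictions -/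

/-- `dfun` as a difference of one point indicator in `y`. -/
theorem dfun_eq_pt (a b γ r z w : ZMod 5) (ha : a ≠ 0) :
    ∃ q : ZMod 5, ∀ y, dfun a b γ r y z w = xor (pt q y) (pt q (y - 1)) := by
  obtain ⟨q, hq⟩ := line_eq_pt a (b * z + γ * w) r ha
  refine ⟨q, fun y => ?_⟩
  unfold dfun
  have e1 : a * y + b * z + γ * w = a * y + (b * z + γ * w) := by ring
  have e2 : a * (y - 1) + b * z + γ * w = a * (y - 1) + (b * z + γ * w) := by ring
  rw [e1, e2, hq y, hq (y - 1)]

/-- `cfun` as a difference of two point indicators in `y`, at distinct points. -/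
theorem cfun_eq_pt (a b γ r t w : ZMod 5) (ha : a ≠ 0) (hb : b ≠ 0) :
    ∃ q μ : ZMod 5, μ ≠ 0 ∧ ∀ y, cfun a b γ r y t w =
      xor (xor (pt q y) (pt q (y - 1))) (xor (pt (q + μ) y) (pt (q + μ) (y - 1))) := by
  obtain ⟨q, μ, hμ, h1, h2⟩ := line_pair_eq_pt a b (b * t + γ * w) r ha hb
  refine ⟨q, μ, hμ, fun y => ?_⟩
  unfold cfun
  have e1 : a * y + b * t + γ * w = a * y + (b * t + γ * w) := by ring
  have e2 : a * (y - 1) + b * t + γ * w = a * (y - 1) + (b * t + γ * w) := by ring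
  have e3 : a * y + b * (t - 1) + γ * w = a * y + (b * t + γ * w - b) := by ring
  have e4 : a * (y - 1) + b * (t - 1) + γ * w = a * (y - 1) + (b * t + γ * w - b) := by ring
  rw [e1, e2, e3, e4, h1 y, h1 (y - 1), h2 y, h2 (y - 1)]

/-- **Y-FAMILY LEMMA**: `δ_h = c_{nbr}` cannot hold along five consecutive values of `N(π)` with `N(ρ_h)`, `N(h)`, `W` fixed
(`a ≠ 0` the `π`-coefficient of `h`; `a', b' ≠ 0` the coefficients of the neighbour). -/
theorem yfam_false (a b γ r z w a' b' γ' r' t w' y₀ : ZMod 5) (ha : a ≠ 0) (ha' : a' ≠ 0) (hb' : b' ≠ 0)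
    (h : ∀ j : ℕ, j < 5 → dfun a b γ r (y₀ + (j : ℕ)) z w = cfun a' b' γ' r' (y₀ + (j : ℕ)) t w') : False := by
  obtain ⟨q₀, hq₀⟩ := dfun_eq_pt a b γ r z w ha
  obtain ⟨q, μ, hμ, hq⟩ := cfun_eq_pt a' b' γ' r' t w' ha' hb'
  apply three_point q₀ q μ hμ
  intro y
  obtain ⟨j, hj, e⟩ := exists_step_eq y₀ y
  have := h j hj
  rw [e, hq₀, hq] at this
  exact this

/-- **T-FAMILY LEMMA**: a constant `d` equal to `c_{nbr}` along five consecutive values of `N(h)` (with `N(π)`, `W` fixed) is `0`. -/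
theorem tfam_zero (a' b' γ' r' y w' t₀ : ZMod 5) (d : Bool)
    (h : ∀ j : ℕ, j < 5 → d = cfun a' b' γ' r' y (t₀ + (j : ℕ)) w') : d = false := by
  apply const_eq_diff (fun t => xor (decide (a' * y + b' * t + γ' * w' = r')) (decide (a' * (y - 1) + b' * t + γ' * w' = r'))) d
  intro t
  obtain ⟨j, hj, e⟩ := exists_step_eq t₀ t
  have := h j hj
  rw [e] at this
  unfold cfun at this
  exact this

/-- `cfun` as a function of the line value `L = a y + b t + γ w`. -/
theorem cfun_eq_of_line (a b γ r y t w : ZMod 5) :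
    cfun a b γ r y t w = xor (xor (decide (a * y + b * t + γ * w = r)) (decide (a * y + b * t + γ * w = r + a)))
      (xor (decide (a * y + b * t + γ * w = r + b)) (decide (a * y + b * t + γ * w = r + a + b))) := by
  unfold cfun
  have e2 : (a * (y - 1) + b * t + γ * w = r) ↔ (a * y + b * t + γ * w = r + a) := by
    constructor <;> intro e <;> linear_combination e
  have e3 : (a * y + b * (t - 1) + γ * w = r) ↔ (a * y + b * t + γ * w = r + b) := by
    constructor <;> intro e <;> linear_combination e
  have e4 : (a * (y - 1) + b * (t - 1) + γ * w = r) ↔ (a * y + b * t + γ * w = r + a + b) := by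
    constructor <;> intro e <;> linear_combination e
  simp only [e2, e3, e4]

/-- **LINE-WITNESS LEMMA**: along an arithmetic progression of the line value with non-zero step, `cfun` takes the value `1`
(`a, b ≠ 0`): for every start there is `j < 5` with `cfun = 1` at line value `L₀ + j κ`. -/
theorem exists_cfun_true (a b γ r : ZMod 5) (ha : a ≠ 0) (hb : b ≠ 0) (κ : ZMod 5) (hκ : κ ≠ 0)
    (y t w : ℕ → ZMod 5) (L₀ : ZMod 5) (hL : ∀ j : ℕ, j < 5 → a * y j + b * t j + γ * w j = L₀ + κ * (j : ℕ)) :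
    ∃ j : ℕ, j < 5 ∧ cfun a b γ r (y j) (t j) (w j) = true := by
  obtain ⟨v, hv⟩ := oddSet_nonempty a b r ha hb
  obtain ⟨j, hj, e⟩ := exists_step_hit κ L₀ v hκ
  refine ⟨j, hj, ?_⟩
  rw [cfun_eq_of_line, hL j hj, e]
  exact hv

/-- the value of `dfun` is `1` when the line value hits `r`. -/
theorem dfun_true_of_hit (a b γ r y z w : ZMod 5) (h : a * y + b * z + γ * w = r) (ha : a ≠ 0) : dfun a b γ r y z w = true := by
  unfold dfun
  rw [decide_eq_true h]
  have : ¬ (a * (y - 1) + b * z + γ * w = r) := by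
    intro e
    apply ha
    linear_combination h - e
  rw [decide_eq_false this]
  rfl

/-- … or hits `r + a`. -/
theorem dfun_true_of_hit' (a b γ r y z w : ZMod 5) (h : a * y + b * z + γ * w = r + a) (ha : a ≠ 0) :
    dfun a b γ r y z w = true := by
  unfold dfun
  have h2 : a * (y - 1) + b * z + γ * w = r := by linear_combination h
  have h1 : ¬ (a * y + b * z + γ * w = r) := by
    intro e
    apply ha
    linear_combination e - h
  rw [decide_eq_true h2, decide_eq_false h1]
  rfl

end RungU

end Summit.QuantumAdvantage.AdviceFreeQNC0.LocalEngine
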